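import Literature.MathematicalPhysics.StatisticalMechanics.HardSphereContactTheoremProofs
import HarnessLib

/-!
# The labelled `k`-point laws of the canonical hard-sphere gas on `𝕋³`

Topic `Literature/MathematicalPhysics/KineticTheory` (companion of `HardSphereCanonicalKS`,
`HardSphereCanonicalKSLimit`; the function form of the pair-event identity `posGibbs_real_pairEvent`
of `StatisticalMechanics/HardSphereContactTheoremProofs`).

For `n` hard spheres of diameter `ε` on the unit flat torus `𝕋³` with uniform activity, the
configurational canonical Gibbs measure `P = posGibbsMeasure 1 ε n` is the product Haar measure
restricted to the hard-core set `hcSet ε n` and normalised by `Ξ_ε(n) = XiT ε n`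
(`posGibbsMeasure_one_eq`).  We prove that the joint law under `P` of any `k` DISTINCT labelled
spheres `(x_{ℓ 0}, …, x_{ℓ (k-1)})`, `ℓ : Fin k → Fin n` injective, has the density
`v_n = vcan ε n` of `HardSphereCanonicalKSLimit` (the normalised pinned hard-core probability
`u_ε(y)(n − k)/Ξ_ε(n)`) with respect to Haar^{⊗k}:

  `∫ F(x ∘ ℓ) dP(x) = ∫_{(𝕋³)^k} F(y) v_n(y) dy`      (`integral_posGibbs_comp_eq_integral_mul_vcan`)

for every bounded measurable `F`, i.e. `v_n` IS the labelled `k`-point correlation function of the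
canonical gas in the density normalisation (`ρ_k^{(n)} (n−k)!/n!`).  Ingredients:
* exchangeability — relabelling along a bijection of the labels extending `ℓ`
  (`exists_equiv_extend_castAdd`) preserves Haar^{⊗n} (`measurePreserving_comp_equiv`) and the
  hard-core set (`comp_equiv_mem_hcSet_iff`);
* Fubini along the juxtaposition `(𝕋³)^k × (𝕋³)^m ≅ (𝕋³)^{k+m}` (`appendMEquiv`,
  `volume_preserving_appendMEquiv`), under which the hard-core set of `k + m` points becomes the
  pinned hard-core event `PinnedHC ε y ·` of the last `m` points around the first `k`
  (`append_mem_hcSet_iff`), whose Haar measure is `u_ε(y)(m) = pinnedXi ε y m` by definition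
  (`setIntegral_hcSet_castAdd_eq`).
The two- and four-label specialisations (`integral_pairLabel_eq_integral_mul_vcan`,
`integral_quadLabel_eq_integral_mul_vcan`) are packaged along the hydrodynamic scaling
`ε = ε_N`, `n = N + 1` in `integral_labelLaw_eq_integral_mul_vcan`.

## References

* J.-P. Hansen, I. R. McDonald, *Theory of Simple Liquids*, 4th ed. (2013), §2.5 (reduced particle
  densities of the canonical ensemble).  [HansenMcdonald2013]
* E. Pulvirenti, D. Tsagkarogiannis, Comm. Math. Phys. 316 (2012) 289–306, §3, §5 (canonical
  hard-core partition functions; the setting of `HardSphereCanonicalKS(Limit)`).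
  [PulvirentiTsagkarogiannis2012]
* D. Ruelle, *Statistical Mechanics: Rigorous Results* (1969), §4.1–4.2 (correlation functions).
  [Ruelle1969]

## Not here

No thermodynamic limit (`HardSphereCanonicalKSLimit.tendsto_vcan_sub_ksCorr`), no velocities.
-/

noncomputable section

open MeasureTheory Set Filter Function
open scoped ENNReal BigOperators Topology Classical

namespace Literature.MathematicalPhysics.KineticTheory

open StatisticalMechanics Literature.Analysis.FluidPDE

/-! ### The uniform canonical measure as a normalised restriction -/

/-- `posGibbsMeasure 1 ε n = Ξ_ε(n)⁻¹ · Haar^{⊗n}|_{hcSet ε n}`. [folklore] -/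
theorem posGibbsMeasure_one_eq (ε : ℝ) (n : ℕ) :
    posGibbsMeasure (fun _ : T3 => (1 : ℝ)) ε n =
      ENNReal.ofReal (XiT ε n)⁻¹ • (volume : Measure (Fin n → T3)).restrict (hcSet ε n) := by
  rw [posGibbsMeasure_eq continuous_const (fun _ => one_pos) ε n, profileOf_one_μ, Xi,
    firstLabels_self, profileOf_one_μ, ← XiT_eq_hcProb, hardCoreSet_univ_eq_hcSet, ← volume_pi]

/-- Integration against the uniform canonical measure:
`∫ G dP = Ξ_ε(n)⁻¹ ∫_{hcSet ε n} G dx`. [folklore] -/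
theorem integral_posGibbs_one_eq (ε : ℝ) (n : ℕ) (G : (Fin n → T3) → ℝ) :
    ∫ x, G x ∂posGibbsMeasure (fun _ : T3 => (1 : ℝ)) ε n = (XiT ε n)⁻¹ * ∫ x in hcSet ε n, G x := by
  rw [posGibbsMeasure_one_eq, integral_smul_measure,
    ENNReal.toReal_ofReal (inv_nonneg.2 (XiT_nonneg ε n)), smul_eq_mul]

/-! ### Exchangeability along a bijection of label types -/

/-- Relabelling along a bijection `e : Fin n' ≃ Fin n` carries Haar^{⊗n} to Haar^{⊗n'}. [folklore] -/
theorem measurePreserving_comp_equiv {n n' : ℕ} (e : Fin n' ≃ Fin n) :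
    MeasurePreserving (fun x : Fin n → T3 => x ∘ e) volume volume :=
  (volume_measurePreserving_piCongrLeft (fun _ : Fin n => T3) e).symm

/-- Relabelling along a bijection of label types is a measurable embedding. [folklore] -/
theorem measurableEmbedding_comp_equiv {n n' : ℕ} (e : Fin n' ≃ Fin n) :
    MeasurableEmbedding (fun x : Fin n → T3 => x ∘ e) :=
  (MeasurableEquiv.piCongrLeft (fun _ : Fin n => T3) e).symm.measurableEmbedding

/-- The hard-core set is invariant under relabelling along a bijection of label types. [folklore] -/
theorem comp_equiv_mem_hcSet_iff (ε : ℝ) {n n' : ℕ} (e : Fin n' ≃ Fin n) (x : Fin n → T3) :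
    x ∘ e ∈ hcSet ε n' ↔ x ∈ hcSet ε n := by
  simp only [hcSet, mem_setOf_eq, Function.comp_apply]
  constructor
  · intro h i j hij
    have := h (e.symm i) (e.symm j) (by simpa using hij)
    simpa using this
  · intro h i j hij
    exact h _ _ (e.injective.ne hij)

/-- An injective labelling `ℓ : Fin k → Fin n` extends to a bijection `Fin (k + (n − k)) ≃ Fin n`
which is `ℓ` on the first `k` labels. [folklore] -/
theorem exists_equiv_extend_castAdd {k n : ℕ} {lab : Fin k → Fin n} (h : Injective lab) :
    ∃ e : Fin (k + (n - k)) ≃ Fin n, ∀ a, e (Fin.castAdd (n - k) a) = lab a := by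
  classical
  have hk : Fintype.card ↥(Set.range lab) = k := by
    rw [Set.card_range_of_injective h, Fintype.card_fin]
  have hc : Fintype.card ↥((Set.range lab)ᶜ) = n - k := by
    rw [Fintype.card_compl_set, Fintype.card_fin, hk]
  refine ⟨finSumFinEquiv.symm.trans (((Equiv.ofInjective lab h).sumCongr
    (Fintype.equivFinOfCardEq hc).symm).trans (Equiv.Set.sumCompl (Set.range lab))), fun a => ?_⟩
  simp [Equiv.Set.sumCompl_apply_inl]

/-! ### The hard-core set along the juxtaposition `(𝕋³)^k × (𝕋³)^m ≅ (𝕋³)^{k+m}` -/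

/-- Splitting the labels into the first `k` and the last `m`, the hard-core set of `k + m` points is
the pinned hard-core event of the last `m` points around the first `k`. [folklore] -/
theorem append_mem_hcSet_iff (ε : ℝ) {k m : ℕ} (y : Fin k → T3) (x : Fin m → T3) :
    Fin.append y x ∈ hcSet ε (k + m) ↔ PinnedHC ε y x := by
  simp only [hcSet, mem_setOf_eq, PinnedHC]
  constructor
  · intro h
    refine ⟨fun a b hab => ?_, fun i a => ?_, fun i j hij => ?_⟩
    · have h' := h (Fin.castAdd m a) (Fin.castAdd m b) fun e => hab (Fin.castAdd_injective _ _ e)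
      rwa [Fin.append_left, Fin.append_left] at h'
    · have hne : Fin.natAdd k i ≠ Fin.castAdd m a := by
        intro e
        have := congrArg Fin.val e
        simp only [Fin.val_natAdd, Fin.val_castAdd] at this
        omega
      have h' := h (Fin.natAdd k i) (Fin.castAdd m a) hne
      rwa [Fin.append_right, Fin.append_left] at h'
    · have h' := h (Fin.natAdd k i) (Fin.natAdd k j) fun e => hij (Fin.natAdd_injective _ _ e)
      rwa [Fin.append_right, Fin.append_right] at h'
  · rintro ⟨h1, h2, h3⟩ i j
    refine Fin.addCases (motive := fun i => i ≠ j → ¬ Ov ε (Fin.append y x i) (Fin.append y x j))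
      (fun a => ?_) (fun i' => ?_) i <;>
    refine Fin.addCases (motive := fun j => _ ≠ j → ¬ Ov ε (Fin.append y x _) (Fin.append y x j))
      (fun b => ?_) (fun j' => ?_) j <;> intro hne
    · rw [Fin.append_left, Fin.append_left]
      exact h1 a b fun e => hne (by rw [e])
    · rw [Fin.append_left, Fin.append_right, not_ov_comm]
      exact h2 j' a
    · rw [Fin.append_right, Fin.append_left]
      exact h2 i' b
    · rw [Fin.append_right, Fin.append_right]
      exact h3 i' j' fun e => hne (by rw [e])

/-- **Integrating out the last `m` labels on the hard-core set** (Fubini along the juxtaposition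
map): for bounded measurable `F` of the first `k` points,
`∫_{hcSet ε (k+m)} F(x|_{first k}) dx = ∫ F(y) u_ε(y)(m) dy`. [folklore] -/
theorem setIntegral_hcSet_castAdd_eq (ε : ℝ) (k m : ℕ) {F : (Fin k → T3) → ℝ} (hF : Measurable F)
    (hB : ∃ C : ℝ, ∀ y, |F y| ≤ C) :
    ∫ x in hcSet ε (k + m), F (fun a => x (Fin.castAdd m a)) = ∫ y, F y * pinnedXi ε y m := by
  obtain ⟨C, hC⟩ := hB
  have hmp := volume_preserving_appendMEquiv T3 k m
  have hS : MeasurableSet {q : (Fin k → T3) × (Fin m → T3) | PinnedHC ε q.1 q.2} :=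
    measurableSet_setOf_pinnedHC ε measurable_fst measurable_snd
  -- pull back along the juxtaposition map
  have h1 : ∫ x in hcSet ε (k + m), F (fun a => x (Fin.castAdd m a)) =
      ∫ q in {q : (Fin k → T3) × (Fin m → T3) | PinnedHC ε q.1 q.2}, F q.1 ∂(volume.prod volume) := by
    have hpre : (appendMEquiv T3 k m) ⁻¹' hcSet ε (k + m) =
        {q : (Fin k → T3) × (Fin m → T3) | PinnedHC ε q.1 q.2} := by
      ext q
      rw [mem_preimage, appendMEquiv_apply, append_mem_hcSet_iff, mem_setOf_eq]
    rw [← hmp.setIntegral_preimage_emb (appendMEquiv T3 k m).measurableEmbedding, hpre]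
    refine setIntegral_congr_fun hS fun q _ => ?_
    simp only [appendMEquiv_apply, Fin.append_left]
  -- Fubini
  rw [h1, ← integral_indicator hS, integral_prod]
  · refine integral_congr_ae (ae_of_all _ fun y => ?_)
    have hind : (fun x : Fin m → T3 =>
        {q : (Fin k → T3) × (Fin m → T3) | PinnedHC ε q.1 q.2}.indicator (fun q => F q.1) (y, x)) =
          (pinnedSet ε y m).indicator fun _ => F y := by
      funext x
      simp only [Set.indicator, mem_setOf_eq, pinnedSet]
    simp only [hind, integral_indicator_const _ (measurableSet_pinnedSet ε y m), smul_eq_mul, pinnedXi,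
      mul_comm]
  · exact (Integrable.of_bound (hF.comp measurable_fst).aestronglyMeasurable C
      (ae_of_all _ fun q => by simpa [Real.norm_eq_abs] using hC q.1)).indicator hS

/-! ### The labelled `k`-point law -/

/-- **The labelled `k`-point law of the canonical hard-sphere gas has density `v_n`**: for distinct
labels `ℓ 0, …, ℓ (k−1)` (`ℓ : Fin k → Fin n` injective) and bounded measurable `F`,
`∫ F(x_{ℓ 0}, …, x_{ℓ (k−1)}) dP(x) = ∫ F(y) v_n(y) dy` for `P = posGibbsMeasure 1 ε n`, with
`v_n(y) = u_ε(y)(n − k)/Ξ_ε(n)` (both sides vanish in the junk case `Ξ_ε(n) = 0`) — the textbook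
definition of the reduced `k`-particle density of the canonical ensemble, here for hard spheres on
`𝕋³`. [folklore] -/
theorem integral_posGibbs_comp_eq_integral_mul_vcan (ε : ℝ) {n k : ℕ} {lab : Fin k → Fin n}
    (hlab : Injective lab) {F : (Fin k → T3) → ℝ} (hF : Measurable F) (hB : ∃ C : ℝ, ∀ y, |F y| ≤ C) :
    ∫ x, F (fun a => x (lab a)) ∂posGibbsMeasure (fun _ : T3 => (1 : ℝ)) ε n =
      ∫ y, F y * vcan ε n y := by
  obtain ⟨e, he⟩ := exists_equiv_extend_castAdd hlab
  rw [integral_posGibbs_one_eq]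
  -- relabel so that the observed labels come first
  have h2 : ∫ x in hcSet ε n, F (fun a => x (lab a)) =
      ∫ x in hcSet ε (k + (n - k)), F (fun a => x (Fin.castAdd (n - k) a)) := by
    have hpre : (fun x : Fin n → T3 => x ∘ e) ⁻¹' hcSet ε (k + (n - k)) = hcSet ε n := by
      ext x; exact comp_equiv_mem_hcSet_iff ε e x
    rw [← (measurePreserving_comp_equiv e).setIntegral_preimage_emb (measurableEmbedding_comp_equiv e)
      (fun x => F fun a => x (Fin.castAdd (n - k) a)) (hcSet ε (k + (n - k))), hpre]
    simp only [Function.comp_apply, he]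
  -- integrate out the free labels
  rw [h2, setIntegral_hcSet_castAdd_eq ε k (n - k) hF hB, ← integral_const_mul]
  refine integral_congr_ae (ae_of_all _ fun y => ?_)
  simp only [vcan]
  ring

/-- **The labelled pair law**: for `i ≠ j` and bounded measurable `F`,
`∫ F(x_i, x_j) dP(x) = ∫ F(y) v_n(y) dy`, `P = posGibbsMeasure 1 ε n`. [folklore] -/
theorem integral_pairLabel_eq_integral_mul_vcan (ε : ℝ) {n : ℕ} {i j : Fin n} (hij : i ≠ j)
    {F : (Fin 2 → T3) → ℝ} (hF : Measurable F) (hB : ∃ C : ℝ, ∀ y, |F y| ≤ C) :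
    ∫ x, F ![x i, x j] ∂posGibbsMeasure (fun _ : T3 => (1 : ℝ)) ε n =
      ∫ y : Fin 2 → T3, F y * vcan ε n y := by
  have hlab : Injective (![i, j] : Fin 2 → Fin n) := by
    intro a b h
    fin_cases a <;> fin_cases b <;> simp_all [hij.symm]
  have hvec : ∀ x : Fin n → T3, (![x i, x j] : Fin 2 → T3) = fun a => x (![i, j] a) := by
    intro x; funext a; fin_cases a <;> rfl
  simp only [hvec]
  exact integral_posGibbs_comp_eq_integral_mul_vcan ε hlab hF hB

/-- **The labelled four-point law**: for pairwise distinct `i, j, k, l` and bounded measurable `F`,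
`∫ F(x_i, x_j, x_k, x_l) dP(x) = ∫ F(y) v_n(y) dy`, `P = posGibbsMeasure 1 ε n`. [folklore] -/
theorem integral_quadLabel_eq_integral_mul_vcan (ε : ℝ) {n : ℕ} {i j k l : Fin n} (hij : i ≠ j)
    (hik : i ≠ k) (hil : i ≠ l) (hjk : j ≠ k) (hjl : j ≠ l) (hkl : k ≠ l)
    {F : (Fin 4 → T3) → ℝ} (hF : Measurable F) (hB : ∃ C : ℝ, ∀ y, |F y| ≤ C) :
    ∫ x, F ![x i, x j, x k, x l] ∂posGibbsMeasure (fun _ : T3 => (1 : ℝ)) ε n =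
      ∫ y : Fin 4 → T3, F y * vcan ε n y := by
  have hlab : Injective (![i, j, k, l] : Fin 4 → Fin n) := by
    intro a b h
    fin_cases a <;> fin_cases b <;>
      simp_all [hij.symm, hik.symm, hil.symm, hjk.symm, hjl.symm, hkl.symm]
  have hvec : ∀ x : Fin n → T3,
      (![x i, x j, x k, x l] : Fin 4 → T3) = fun a => x (![i, j, k, l] a) := by
    intro x; funext a; fin_cases a <;> rfl
  simp only [hvec]
  exact integral_posGibbs_comp_eq_integral_mul_vcan ε hlab hF hB

/-- **The labelled two- and four-point laws along the hydrodynamic scaling** (`ε = ε_N`,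
`n = N + 1` particles): under `P_N = posGibbsMeasure 1 ε_N (N+1)` the law of `(x_i, x_j)`
(`i ≠ j`) and of `(x_i, x_j, x_k, x_l)` (pairwise distinct) have density `vcan ε_N (N+1)` with
respect to Haar measure on `(𝕋³)²`, `(𝕋³)⁴`.  (The small-density hypothesis is not needed for the
identity; it is recorded for the consumer's normalisation `Ξ > 0`, `XiT_pos`.) [folklore] -/
theorem integral_labelLaw_eq_integral_mul_vcan :
    ∀ σ : ℝ, SmallDensity uniformProfile σ → ∀ (N : ℕ),
      (∀ (i j : Fin (N + 1)), i ≠ j → ∀ F : (Fin 2 → T3) → ℝ, Measurable F → (∃ C : ℝ, ∀ y, |F y| ≤ C) →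
        ∫ x, F ![x i, x j] ∂posGibbsMeasure (fun _ : T3 => (1 : ℝ)) (hsDiameter σ N) (N + 1) =
          ∫ y : Fin 2 → T3, F y * vcan (hsDiameter σ N) (N + 1) y) ∧
      (∀ (i j k l : Fin (N + 1)), i ≠ j → i ≠ k → i ≠ l → j ≠ k → j ≠ l → k ≠ l →
        ∀ F : (Fin 4 → T3) → ℝ, Measurable F → (∃ C : ℝ, ∀ y, |F y| ≤ C) →
        ∫ x, F ![x i, x j, x k, x l] ∂posGibbsMeasure (fun _ : T3 => (1 : ℝ)) (hsDiameter σ N) (N + 1) =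
          ∫ y : Fin 4 → T3, F y * vcan (hsDiameter σ N) (N + 1) y) :=
  fun σ _ N =>
    ⟨fun _ _ hij _ hF hB => integral_pairLabel_eq_integral_mul_vcan (hsDiameter σ N) hij hF hB,
      fun _ _ _ _ hij hik hil hjk hjl hkl _ hF hB =>
        integral_quadLabel_eq_integral_mul_vcan (hsDiameter σ N) hij hik hil hjk hjl hkl hF hB⟩

end Literature.MathematicalPhysics.KineticTheory
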